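import Summits.Langlands.Langlands.Theorems.IrreducibilityBySelfDualityPairLBoundaryJSCornerUnitBoxPeel

/-!
# Crux `PairLBoundaryJS` (stmt-Langlands-13622), line `Sketch` — stub `stub_corner_unitBox_productForm` (W-CPF):
# support collapse and product form of the translated CORNER pair integrand on the unit box

Summit `Langlands`, sub-problem `Langlands`, helper file under `Theorems/` supporting the crux
`PairLBoundaryJS` (Arthur–Clozel (1989), Ch. 3, (2.2)), line `Sketch`, registered stub
`stub_corner_unitBox_productForm` (part 3 of 3: parts 1–2 are `…CornerUnitBoxLocalValue`, `…CornerUnitBoxPeel`).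

The bad-place step of the Rankin–Selberg method for the CORNER pair `GL_{m+1} × GL_m`
(Jacquet–Piatetski-Shapiro–Shalika (1983), §2, (2.7): at a finite place the local corner integral of suitable
data is a non-zero constant; Cogdell (2004), §4.1: `Ψ = ∏_v Ψ_v` for factorizable data), in the tree's torus
coordinates and abstractly in `W` on `GL_{m+1}(𝔸_K)` and `W'` on `GL_m(𝔸_K)`: the `GL_{m+1} × GL_m` transcription
of `UnitBoxTranslateProductForm.stub_unitBox_translate_productForm`. Along the corner `ι = glCorner : g ↦ diag(g, 1)`
the last row is exactly `e_{m+1}`, so there is no test function and no depth hypothesis.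

* `setIntegral_corner_eq_unitBox_univ` — **part (i)**: the corner pair integrand of `W(diag(τ, 1) ι ·)` over
  `B({v ∉ T}) × K` equals its integral over `B(all) × K` (the corner support theorem
  `valued_eq_one_of_corner_ne_zero` of part 2 at every `v ∈ T`, where `diag(τ, 1)_v = 1`);
* `stub_corner_unitBox_productForm` — **the registered stub**: (i), and (ii) the product form on `B(all) × K`,
  `I(p) = F((diag a k)_f) · W(diag(τ, 1) (ι(diag a k)_∞, 1)) · W̄'(diag τ ((diag a k)_∞, 1)) · |det a|_∞^s δ⁻¹` with
  `F(κ) = ∏_{v ∈ T} 𝟙[ι(κ_v) ∈ N_v K♯_v]` (the corner local value theorem `corner_pair_apply_mul_ofLocal_eq` of part 1 at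
  each `v ∈ T`, at a common depth `d` below all the levels, peeled by `corner_pair_eq_prod_mul_pair` of part 2 from
  the base point `diag τ · ((diag a k)_∞, 1)`); `F ∈ {0, 1}`, `F(1) = 1`, and `F` is right `K_f(𝔪)`-invariant for
  `𝔪 = ∏_{v ∈ T} 𝔭_v^d` (`exists_sharp_mul_iff` on `GL_{m+1}`); the weight factor is `torusWeightC_eq_archTorusWeightC`.

All proofs complete; tree theorems only.

## References

* H. Jacquet, I. I. Piatetski-Shapiro, J. A. Shalika, *Rankin–Selberg convolutions*, Amer. J. Math.
  105 (1983), §2, (2.7) [JacquetPiatetskiShapiroShalika1983].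
* J. W. Cogdell, *Analytic theory of L-functions for GL_n*, in *An Introduction to the Langlands
  Program* (2004), §2.3, §4.1 [CogdellAnalyticTheory2004].
-/

noncomputable section

-- `Summit.Langlands.Langlands.…` (summit = sub-problem name, D-0017 layout) trips `dupNamespace`
set_option linter.dupNamespace false

open scoped MatrixGroups Topology Pointwise ENNReal NNReal ComplexConjugate InnerProductSpace ContDiff
-- the place subtypes indexing `mixedSpace K` are `Fintype` classically (`NormedCommRing (mixedSpace K)`)
open scoped Classical Matrix.Norms.Operator
open NumberField IsDedekindDomain MeasureTheory Measure Matrix Set Filter WithZero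
open NumberField.mixedEmbedding
open Literature.NumberTheory.Automorphic AdelicGroupData
open Literature.NumberTheory.GaloisRepresentations (ideleGroup HeckeCharacter)
open Literature.MeasureTheory.Group
open Literature.RingTheory.SymmetricFunctions.SymmPoly
open ValuativeRel

-- the automorphic quotient carries the tree's Borel σ-algebra, not Mathlib's quotient σ-algebra
attribute [-instance] Quotient.instMeasurableSpace QuotientGroup.measurableSpace

-- the house local instances, exactly as in `RankinSelbergUnfoldingIdentity`
attribute [local instance] adelicBorel borelSpace_adelic locallyCompactSpace_adelic secondCountableTopology_gl_adelic
  glAdeleBorel borelSpace_glAdele borelSpace_ideleGroup secondCountableTopology_ideleGroup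

-- Mathlib idiom: the commutator Lie ring on matrices, to mention `(archGroupGL n K).lie`
attribute [local instance 100] LieRing.ofAssociativeRing

namespace Summit.Langlands.Langlands.Theorems.CornerUnitBoxProductForm

/-! ### Part (i): the support collapse for the translated corner pair -/

section Collapse

variable {m : ℕ} {K : Type} [Field K] [NumberField K]
  [MeasurableSpace (AdeleRing (𝓞 K) K)] [BorelSpace (AdeleRing (𝓞 K) K)]

/-- **Reduction of the `T`-integral of the TRANSLATED corner pair to the unit box at all finite places.** For `W`
on `GL_{m+1}(𝔸_K)` left `ψ`-equivariant, central up to modulus one and spread at every `v ∈ T` (no depth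
hypothesis), a torus element `τ ∈ (𝔸_Kˣ)ᵐ` trivial at the places of `T` and ANY second factor `W₂` on `GL_m(𝔸_K)`,
the corner pair integrand of `(W(diag(τ, 1) ι ·), W₂, 1)` over `B({v ∉ T}) × K` equals its integral over
`B(all) × K`: at a point `(a, k)` off the smaller box `W(diag(τ, 1) ι(diag a k)) = 0` by the corner support theorem
`valued_eq_one_of_corner_ne_zero` at a place `v ∈ T` where some `a_i` is not a unit (`diag(τ, 1)_v = 1`). [folklore] -/
theorem setIntegral_corner_eq_unitBox_univ
    {ψ : AddChar (AdeleRing (𝓞 K) K) Circle} {W : GL (Fin (m + 1)) (AdeleRing (𝓞 K) K) → ℂ}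
    (hWN : ∀ (u : ↥(adelicUnipotent (m + 1) K)) (g : GL (Fin (m + 1)) (AdeleRing (𝓞 K) K)),
      W ((u : GL (Fin (m + 1)) (AdeleRing (𝓞 K) K)) * g) = whittakerCharFun ψ u * W g)
    (hWZ : ∀ (z : ideleGroup K) (g : GL (Fin (m + 1)) (AdeleRing (𝓞 K) K)),
      ‖W (Matrix.GeneralLinearGroup.scalar (Fin (m + 1)) z * g)‖ = ‖W g‖)
    {T : Finset (HeightOneSpectrum (𝓞 K))} (τ : Fin m → ideleGroup K)
    (hτT : ∀ v ∈ T, localComponent v (glDiagonal m (AdeleRing (𝓞 K) K) τ) = 1)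
    (hT : ∀ v ∈ T, ∃ (t : Fin (m + 1) → (v.adicCompletion K)ˣ) (M c₀ : ℤ),
      IsSpreadWhittakerAt v ψ t M W ∧
      (∃ y : v.adicCompletion K, Valued.v y ≤ exp (1 - c₀) ∧ ψ.adicComponent v y ≠ 1) ∧ 1 ≤ M ∧
      (∀ i j : Fin (m + 1), i ≤ j → Valued.v (t j : v.adicCompletion K) ≤ Valued.v (t i : v.adicCompletion K)) ∧
      (∀ i j : Fin (m + 1), (i : ℕ) + 1 = j →
        exp (M - c₀) * Valued.v (t j : v.adicCompletion K) ≤ Valued.v (t i : v.adicCompletion K)))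
    (W₂ : GL (Fin m) (AdeleRing (𝓞 K) K) → ℂ) (s : ℂ)
    (νA : Measure (Fin m → ideleGroup K)) (νK : Measure ↥(maximalCompactAdelic m K)) :
    ∫ p in unitBox {v | v ∉ (↑T : Set (HeightOneSpectrum (𝓞 K)))} ×ˢ Set.univ,
        torusPairIntegrandC m K (fun g => W (glDiagonal (m + 1) (AdeleRing (𝓞 K) K) (Fin.snoc τ 1) *
          glCorner (AdeleRing (𝓞 K) K) (Nat.le_succ m) g)) W₂ (fun _ => (1 : ℝ)) s p ∂(νA.prod νK) =
      ∫ p in unitBox (Set.univ : Set (HeightOneSpectrum (𝓞 K))) ×ˢ Set.univ,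
        torusPairIntegrandC m K (fun g => W (glDiagonal (m + 1) (AdeleRing (𝓞 K) K) (Fin.snoc τ 1) *
          glCorner (AdeleRing (𝓞 K) K) (Nat.le_succ m) g)) W₂ (fun _ => (1 : ℝ)) s p ∂(νA.prod νK) := by
  classical
  set S₁ : Set ((Fin m → ideleGroup K) × ↥(maximalCompactAdelic m K)) :=
    unitBox {v | v ∉ (↑T : Set (HeightOneSpectrum (𝓞 K)))} ×ˢ Set.univ with hS₁
  set S₂ : Set ((Fin m → ideleGroup K) × ↥(maximalCompactAdelic m K)) :=
    unitBox (Set.univ : Set (HeightOneSpectrum (𝓞 K))) ×ˢ Set.univ with hS₂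
  have hsub : S₂ ⊆ S₁ := by
    rintro ⟨a, k⟩ ⟨ha, -⟩
    exact ⟨fun w _ i => ha w (Set.mem_univ w) i, Set.mem_univ _⟩
  have hS₁m : MeasurableSet S₁ := (measurableSet_unitBox _).prod MeasurableSet.univ
  refine setIntegral_eq_of_subset_of_forall_sdiff_eq_zero hS₁m hsub ?_
  rintro ⟨a, k⟩ ⟨hp, hnot⟩
  by_contra hne
  apply hnot
  have hW0 : W (glDiagonal (m + 1) (AdeleRing (𝓞 K) K) (Fin.snoc τ 1) *
      glCorner (AdeleRing (𝓞 K) K) (Nat.le_succ m) (torusPoint m K (a, k))) ≠ 0 := by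
    intro h
    apply hne
    simp only [torusPairIntegrandC, h, zero_mul]
  refine ⟨fun w _ i => ?_, Set.mem_univ _⟩
  by_cases hw : w ∈ T
  · obtain ⟨t, M, c₀, hWv, hψv, hM₁, hmono, hgap⟩ := hT w hw
    exact valued_eq_one_of_corner_ne_zero hWN hWZ hWv hψv hM₁ hmono hgap (localComponent_glDiagonal_snoc (hτT w hw))
      a k hW0 i
  · exact hp.1 w hw i

end Collapse

/-! ### The registered stub -/

/-- **STUB (W-CPF) — support collapse and product form of the translated CORNER pair integrand on the
unit box** (the `GL_{m+1} × GL_m` analogue of `UnitBoxTranslateProductForm.stub_unitBox_translate_productForm`;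
Jacquet–Piatetski-Shapiro–Shalika (1983), §2, (2.7): at a finite place the local corner integral of suitable
data is a non-zero constant; Cogdell (2004), §4.1: `Ψ = ∏_v Ψ_v` for factorizable data). Abstractly in two
functions: `W` on `GL_{m+1}(𝔸_K)` left `ψ`-equivariant, central up to modulus one, right `K_f(𝔫)`-invariant
with the primes of `𝔫` in `T`, spread at every `v ∈ T` (`IsSpreadWhittakerAt`, the inequalities of the
support theorem WITHOUT the depth inequality — along the corner the last row is exactly `e_{m+1}`, so the
thin condition of `valued_eq_one_of_torusIntegrand_thin_ne_zero` holds at every depth); `W'` on `GL_m(𝔸_K)`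
left `ψ`-equivariant, right `K_f(𝔫)`-invariant and right `K_v(𝔭^M)`-invariant at `v ∈ T`; `τ ∈ (𝔸_Kˣ)ᵐ`
trivial at `T`; `I(s) = torusPairIntegrandC m K (W(diag(τ,1) ι ·)) (W̄'(diag τ ·)) 1 s` (`ι = glCorner`).
(i) `∫_{B({v ∉ T}) × K} I = ∫_{B(all) × K} I`; (ii) on `B(all) × K`,
`I(p) = F((diag a k)_f) · W(diag(τ,1) (ι(diag a k)_∞, 1)) · conj W'(diag τ ((diag a k)_∞, 1)) · |det a|_∞^s δ⁻¹`
with `F ∈ {0, 1}`, `F(1) = 1`, `F` right `K_f(𝔪)`-invariant on `GL_m(𝒪̂)` for some `𝔪 ≠ 0`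
(`setIntegral_corner_eq_unitBox_univ`; `corner_pair_apply_mul_ofLocal_eq` at each `v ∈ T` at a common depth, peeled
by `corner_pair_eq_prod_mul_pair`; `torusWeightC_eq_archTorusWeightC`).
[cite: JacquetPiatetskiShapiroShalika1983, §2 (2.7)] [cite: CogdellAnalyticTheory2004, §4.1] -/
theorem stub_corner_unitBox_productForm :
    ∀ {m : ℕ} {K : Type} [Field K] [NumberField K]
      [MeasurableSpace (AdeleRing (𝓞 K) K)] [BorelSpace (AdeleRing (𝓞 K) K)]
      (W : GL (Fin (m + 1)) (AdeleRing (𝓞 K) K) → ℂ) (W' : GL (Fin m) (AdeleRing (𝓞 K) K) → ℂ)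
      (_ : ∀ (u : ↥(adelicUnipotent (m + 1) K)) (g : GL (Fin (m + 1)) (AdeleRing (𝓞 K) K)),
        W ((u : GL (Fin (m + 1)) (AdeleRing (𝓞 K) K)) * g) = whittakerCharFun (adeleAddChar K) u * W g)
      (_ : ∀ (u : ↥(adelicUnipotent m K)) (g : GL (Fin m) (AdeleRing (𝓞 K) K)),
        W' ((u : GL (Fin m) (AdeleRing (𝓞 K) K)) * g) = whittakerCharFun (adeleAddChar K) u * W' g)
      (_ : ∀ (z : ideleGroup K) (g : GL (Fin (m + 1)) (AdeleRing (𝓞 K) K)),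
        ‖W (Matrix.GeneralLinearGroup.scalar (Fin (m + 1)) z * g)‖ = ‖W g‖)
      {𝔫 : Ideal (𝓞 K)} (_ : 𝔫 ≠ 0)
      (_ : ∀ u ∈ finitePrincipalCongruenceLevel (m + 1) K 𝔫, ∀ g : GL (Fin (m + 1)) (AdeleRing (𝓞 K) K),
        W (g * GLn.ofFinite (m + 1) K u) = W g)
      (_ : ∀ u ∈ finitePrincipalCongruenceLevel m K 𝔫, ∀ g : GL (Fin m) (AdeleRing (𝓞 K) K),
        W' (g * GLn.ofFinite m K u) = W' g)
      {T : Finset (HeightOneSpectrum (𝓞 K))} (_ : ∀ w : HeightOneSpectrum (𝓞 K), w.asIdeal ∣ 𝔫 → w ∈ T)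
      (τ : Fin m → ideleGroup K) (_ : ∀ v ∈ T, localComponent v (glDiagonal m (AdeleRing (𝓞 K) K) τ) = 1)
      (_ : ∀ v ∈ T, ∃ (tv : Fin (m + 1) → (v.adicCompletion K)ˣ) (M c₀ : ℤ),
          IsSpreadWhittakerAt v (adeleAddChar K) tv M W ∧
          (∃ y : v.adicCompletion K, Valued.v y ≤ exp (1 - c₀) ∧ (adeleAddChar K).adicComponent v y ≠ 1) ∧ 1 ≤ M ∧
          (∀ i j : Fin (m + 1), i ≤ j → Valued.v (tv j : v.adicCompletion K) ≤ Valued.v (tv i : v.adicCompletion K)) ∧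
          (∀ i j : Fin (m + 1), (i : ℕ) + 1 = j →
            exp (M - c₀) * Valued.v (tv j : v.adicCompletion K) ≤ Valued.v (tv i : v.adicCompletion K)) ∧
          ∀ κ ∈ valuedCongruenceSubgroup (Fin m) (exp (-M)), ∀ g : GL (Fin m) (AdeleRing (𝓞 K) K),
            W' (g * GLn.ofLocal m K v κ) = W' g)
      (νA : Measure (Fin m → ideleGroup K)) (νK : Measure ↥(maximalCompactAdelic m K)),
    let I : ℂ → (Fin m → ideleGroup K) × ↥(maximalCompactAdelic m K) → ℂ :=
      fun s => torusPairIntegrandC m K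
        (fun g => W (glDiagonal (m + 1) (AdeleRing (𝓞 K) K) (Fin.snoc τ 1) * glCorner (AdeleRing (𝓞 K) K) (Nat.le_succ m) g))
        (fun g => star W' (glDiagonal m (AdeleRing (𝓞 K) K) τ * g)) (fun _ => (1 : ℝ)) s
    ∃ (𝔪 : Ideal (𝓞 K)) (_ : 𝔪 ≠ 0) (F : GL (Fin m) (FiniteAdeleRing (𝓞 K) K) → ℂ),
      (∀ g ∈ glFiniteIntegralLevel m K, ∀ u ∈ finitePrincipalCongruenceLevel m K 𝔪, F (g * u) = F g) ∧
      (∀ g, F g = 0 ∨ F g = 1) ∧ F 1 = 1 ∧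
      ∀ s : ℂ,
        (∫ p in unitBox {v | v ∉ (↑T : Set (HeightOneSpectrum (𝓞 K)))} ×ˢ Set.univ, I s p ∂(νA.prod νK) =
          ∫ p in unitBox (Set.univ : Set (HeightOneSpectrum (𝓞 K))) ×ˢ Set.univ, I s p ∂(νA.prod νK)) ∧
        ∀ p : (Fin m → ideleGroup K) × ↥(maximalCompactAdelic m K),
          p.1 ∈ unitBox (n := m) (K := K) (Set.univ : Set (HeightOneSpectrum (𝓞 K))) →
          I s p = F (GLn.sndHom m K (torusPoint m K p)) *
            (W (glDiagonal (m + 1) (AdeleRing (𝓞 K) K) (Fin.snoc τ 1) *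
              GLn.ofInfinite (m + 1) K (glCorner (mixedSpace K) (Nat.le_succ m) (GLn.toMixed m K (torusPoint m K p)))) *
            conj (W' (glDiagonal m (AdeleRing (𝓞 K) K) τ * GLn.ofInfinite m K (GLn.toMixed m K (torusPoint m K p)))) *
            archTorusWeightC m K s (archTorusOfIdele m K p.1)) := by
  intro m K _ _ _ _ W W' hWN hW'N hWZ 𝔫 h𝔫 hWK hW'K T hT τ hτT hsp νA νK
  dsimp only
  choose tv M c₀ hspW hψv hM1 hmono hgap hW'Kv using hsp
  -- a common depth `d` below all the levels: `exp(-d)|t_0| ≤ exp(-M_v)|t_m|` at every `v ∈ T`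
  have hdepth : ∀ v (hv : v ∈ T), ∃ N : ℕ, exp (-(N : ℤ)) * Valued.v (tv v hv 0 : v.adicCompletion K) ≤
      exp (-(M v hv)) * Valued.v (tv v hv (Fin.last m) : v.adicCompletion K) := fun v hv =>
    exists_nat_exp_neg_mul_le ((Valuation.ne_zero_iff _).2 (tv v hv (Fin.last m)).ne_zero) (M v hv)
  choose N hN using hdepth
  set d : ℕ := ∑ w ∈ T.attach, N w.1 w.2 with hd
  have hmt : ∀ v (hv : v ∈ T), exp (-(d : ℤ)) * Valued.v (tv v hv 0 : v.adicCompletion K) ≤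
      exp (-(M v hv)) * Valued.v (tv v hv (Fin.last m) : v.adicCompletion K) := fun v hv => by
    have hle : N v hv ≤ d :=
      Finset.single_le_sum (f := fun w : {w // w ∈ T} => N w.1 w.2) (fun _ _ => Nat.zero_le _)
        (Finset.mem_attach T ⟨v, hv⟩)
    exact (mul_le_mul_left (exp_le_exp.2 (by omega)) _).trans (hN v hv)
  -- the level `𝔪 = ∏_{v ∈ T} 𝔭_v^d`
  have h𝔪0 : (∏ v ∈ T, v.asIdeal ^ d : Ideal (𝓞 K)) ≠ 0 := UnitBoxTranslateProductForm.prod_pow_asIdeal_ne_zero T d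
  have h𝔪rad : ∀ v ∈ T, idealRadius K v (∏ w ∈ T, w.asIdeal ^ d) ≤ exp (-(d : ℤ)) := fun v hv =>
    UnitBoxTranslateProductForm.idealRadius_prod_pow_le d hv
  -- the local indicators `J_v = 𝟙[ι(·) ∈ N_v K♯_v]` (`1` off `T`)
  set J : (v : HeightOneSpectrum (𝓞 K)) → GL (Fin m) (v.adicCompletion K) → ℂ := fun v x =>
    if hv : v ∈ T then
      (if ∃ u ∈ upperUnitriangular (Fin (m + 1)) (v.adicCompletion K), ∃ k : GL (Fin (m + 1)) (v.adicCompletion K),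
          (k ∈ valuedCongruenceSubgroup (Fin (m + 1)) (exp (-(M v hv))) ∧
            ∀ g : GL (Fin (m + 1)) (AdeleRing (𝓞 K) K), W (g * GLn.ofLocal (m + 1) K v k) = W g) ∧
            glCorner (v.adicCompletion K) (Nat.le_succ m) x = u * k
        then 1 else 0)
    else 1 with hJdef
  have hJ : ∀ v ∈ T, ∀ g' : GL (Fin m) (AdeleRing (𝓞 K) K), localComponent v g' = 1 →
      ∀ x : GL (Fin m) (v.adicCompletion K),
        W (glCorner (AdeleRing (𝓞 K) K) (Nat.le_succ m) (g' * GLn.ofLocal m K v x)) * star (W' (g' * GLn.ofLocal m K v x)) =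
          J v x * (W (glCorner (AdeleRing (𝓞 K) K) (Nat.le_succ m) g') * star (W' g')) := by
    intro v hv g' hg' x
    simp only [hJdef, dif_pos hv]
    rw [map_mul, CornerPairTranslate.glCorner_ofLocal]
    have hG' : localComponent v (glCorner (AdeleRing (𝓞 K) K) (Nat.le_succ m) g') = 1 := by
      rw [CornerPairTranslate.localComponent_glCorner, hg', map_one]
    exact corner_pair_apply_mul_ofLocal_eq hWN hW'N (hspW v hv) (hψv v hv) (hM1 v hv) (hmono v hv) (hgap v hv)
      (hmt v hv) (hW'Kv v hv) hG' hg' x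
  have hJ01 : ∀ v ∈ T, ∀ x : GL (Fin m) (v.adicCompletion K), J v x = 0 ∨ J v x = 1 := by
    intro v hv x
    simp only [hJdef, dif_pos hv]
    split_ifs
    · exact Or.inr rfl
    · exact Or.inl rfl
  refine ⟨∏ v ∈ T, v.asIdeal ^ d, h𝔪0, fun κ => ∏ v ∈ T, J v (localComponent v (GLn.ofFinite m K κ)),
    ?_, ?_, ?_, fun s => ⟨?_, ?_⟩⟩
  · -- right `K_f(𝔪)`-invariance
    intro g _ u hu
    have hu' : ∀ v ∈ T, glCorner (v.adicCompletion K) (Nat.le_succ m) (localComponent v (GLn.ofFinite m K u)) ∈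
        valuedCongruenceSubgroup (Fin (m + 1)) (exp (-(d : ℤ))) := fun v hv =>
      (glCorner_mem_valuedCongruenceSubgroup_iff _).2 (valuedCongruenceSubgroup_mono (Fin m) (h𝔪rad v hv)
        (((mem_principalCongruenceLevel_iff).1 (mem_finitePrincipalCongruenceLevel_iff.1 hu)).2 v))
    refine Finset.prod_congr rfl fun v hv => ?_
    rw [map_mul, UnitBoxTranslateProductForm.localComponent_mul]
    simp only [hJdef, dif_pos hv]
    refine if_congr ?_ rfl rfl
    rw [map_mul]
    exact UnitBoxTranslateProductForm.exists_sharp_mul_iff (hspW v hv) (hmono v hv) (hmt v hv) _ (hu' v hv)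
  · -- values in `{0, 1}`
    intro g
    exact UnitBoxTranslateProductForm.prod_eq_zero_or_one T fun v hv => hJ01 v hv _
  · -- `F(1) = 1`
    refine Finset.prod_eq_one fun v hv => ?_
    rw [map_one, UnitBoxTranslateProductForm.localComponent_one]
    simp only [hJdef, dif_pos hv]
    rw [if_pos]
    exact ⟨1, one_mem _, 1, ⟨one_mem _, fun g => by rw [map_one, mul_one]⟩, by rw [map_one, one_mul]⟩
  · -- (i) the support collapse
    exact setIntegral_corner_eq_unitBox_univ hWN hWZ τ hτT
      (fun v hv => ⟨tv v hv, M v hv, c₀ v hv, hspW v hv, hψv v hv, hM1 v hv, hmono v hv, hgap v hv⟩) _ s νA νK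
  · -- (ii) the product form on the unit box
    rintro ⟨a, k⟩ ha
    dsimp only at ha ⊢
    set tp : GL (Fin m) (AdeleRing (𝓞 K) K) := torusPoint m K (a, k) with htp
    set g₀ : GL (Fin m) (AdeleRing (𝓞 K) K) :=
      glDiagonal m (AdeleRing (𝓞 K) K) τ * GLn.ofInfinite m K (GLn.toMixed m K tp) with hg₀
    simp only [torusPairIntegrandC, Pi.star_apply, Complex.ofReal_one, mul_one]
    have hwt : torusWeightC m K s a = archTorusWeightC m K s (archTorusOfIdele m K a) :=
      torusWeightC_eq_archTorusWeightC s ha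
    -- `diag(τ, 1) ι(g) = ι(diag τ g)`
    have hιτ : ∀ g : GL (Fin m) (AdeleRing (𝓞 K) K), glDiagonal (m + 1) (AdeleRing (𝓞 K) K) (Fin.snoc τ 1) *
        glCorner (AdeleRing (𝓞 K) K) (Nat.le_succ m) g =
          glCorner (AdeleRing (𝓞 K) K) (Nat.le_succ m) (glDiagonal m (AdeleRing (𝓞 K) K) τ * g) := fun g => by
      rw [map_mul, glCorner_glDiagonal_eq_glDiagonal_snoc]
    -- hypotheses of the peeling at `S = T`
    have h1 : ∀ v ∈ T, localComponent v g₀ = 1 := fun v hv => by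
      rw [hg₀, UnitBoxTranslateProductForm.localComponent_mul, hτT v hv, UnitBoxTranslateProductForm.localComponent_ofInfinite,
        one_mul]
    have h3 : ∀ w, w ∉ T → (localComponent w g₀)⁻¹ * localComponent w (glDiagonal m (AdeleRing (𝓞 K) K) τ * tp) ∈
        valuedCongruenceSubgroup (Fin m) (1 : ℤᵐ⁰) := fun w _ => by
      rw [hg₀, UnitBoxTranslateProductForm.localComponent_mul, UnitBoxTranslateProductForm.localComponent_mul,
        UnitBoxTranslateProductForm.localComponent_ofInfinite, mul_one, ← mul_assoc, inv_mul_cancel, one_mul,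
        ← glInt_adicCompletion_eq]
      exact localComponent_torusPoint_mem_glInt (fun i => ha w (Set.mem_univ w) i) k
    have h4 : GLn.fstHom m K (glDiagonal m (AdeleRing (𝓞 K) K) τ * tp) = GLn.fstHom m K g₀ := by
      rw [hg₀, map_mul, map_mul, GLn.fstHom_ofInfinite, GLn.toMixed_apply, MulEquiv.symm_apply_apply]
    have hkey := corner_pair_eq_prod_mul_pair h𝔫 hWK hW'K hT J hJ T subset_rfl
      (glDiagonal m (AdeleRing (𝓞 K) K) τ * tp) g₀ h1 (fun w hw hw' => absurd hw' hw) h3 h4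
    have hprod : (∏ v ∈ T, J v (localComponent v (GLn.ofFinite m K (GLn.sndHom m K tp)))) =
        ∏ v ∈ T, J v (localComponent v (glDiagonal m (AdeleRing (𝓞 K) K) τ * tp)) :=
      Finset.prod_congr rfl fun v hv => by
        rw [UnitBoxTranslateProductForm.localComponent_ofFinite_sndHom, UnitBoxTranslateProductForm.localComponent_mul,
          hτT v hv, one_mul]
    rw [hιτ, hwt, hprod, hkey, hg₀, map_mul, glCorner_glDiagonal_eq_glDiagonal_snoc, glCorner_ofInfinite]
    simp only [starRingEnd_apply]
    ring

end Summit.Langlands.Langlands.Theorems.CornerUnitBoxProductForm
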